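import Mathlib.Analysis.Calculus.BumpFunction.InnerProduct
import Literature.Analysis.FunctionSpaces.L2TemperedDistributionLaplacian
import Literature.Analysis.FunctionSpaces.SobolevBesselProductLaw
import HarnessLib

/-!
# Local Sobolev regularity `H^s_loc` of continuous functions: calculus, products, local elliptic regularity, Sobolev lemma

Analysis/FunctionSpaces support file (fifth of the chain discharging
`Literature.Analysis.FluidPDE.tsai1998_profile_smooth`, Tsai 1998, p. 33). It packages the
whole-space results of `L2TemperedDistribution(Laplacian)`, `SobolevFourierEmbedding` and
`SobolevBesselProductLaw` into the local form in which the interior-regularity bootstrap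
(Folland, *Introduction to PDE*, 2nd ed., §6.C) consumes them.

* `LocallyHs s h` — **`h ∈ H^s_loc`** for a function `h : E → ℂ`: for every smooth compactly
  supported cut-off `χ`, the distribution `T_{χh}` of `χh` lies in Mathlib's Bessel-potential
  class `MemSobolev s 2` (Folland, §6.A, Proposition (6.13): "`f ∈ H_s^{loc}(Ω)` if and only
  if `φf ∈ H_s` for every `φ ∈ C_c^∞(Ω)`", here `Ω = E` and `f` a function).
* closure under `+`, constants, finite sums, monotonicity in `s`; `C^k ⊂ H^k_loc`
  (`locallyHs_of_contDiff`) and smooth functions are in every `H^s_loc`;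
* `LocallyHs.fderiv_apply` — `h ∈ C¹ ∩ H^s_loc ⇒ ∂ᵥh ∈ H^{s-1}_loc` (`∂ᵥ : H^s → H^{s-1}` and
  `T_{χ∂ᵥh} = ∂ᵥT_{χh} - T_{(∂ᵥχ)h}`);
* `LocallyHs.mul` — **products**: `h₁, h₂ ∈ C⁰ ∩ H^s_loc`, `d < 2s` ⇒ `h₁h₂ ∈ H^s_loc`
  (the product law, Folland §6.A Exercise 4, after inserting a bump `χ₁ ≡ 1` on `supp χ`);
* `LocallyHs.of_weakLaplacian` — **local elliptic regularity for `Δ`** (Folland, Theorem (6.33)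
  for `L = Δ`, one derivative at a time as in its proof): `P ∈ C¹`, `ΔP = q` weakly with
  `q ∈ C⁰ ∩ H^{s-2}_loc` and `P ∈ H^{s-1}_loc` ⇒ `P ∈ H^s_loc` (the commutator identity
  `laplacian_fnTD_mul_eq` and `MemSobolev.of_laplacian`);
* `LocallyHs.contDiff` — **the local Sobolev lemma** (Folland, Theorem (6.5)/(6.45)):
  `h ∈ C⁰ ∩ H^s_loc`, `d < 2(s - k)` ⇒ `h ∈ C^k`.

## References

* G. B. Folland, *Introduction to Partial Differential Equations*, 2nd ed. (1995), §6.A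
  (Theorem (6.3), Theorem (6.5), Proposition (6.13), Exercise 4), §6.C (Lemma (6.32),
  Theorem (6.33)). [Folland1995PDE]
-/

noncomputable section

open MeasureTheory TemperedDistribution
open scoped ENNReal FourierTransform LineDeriv Laplacian Real SchwartzMap ContDiff

namespace Literature.Analysis.FunctionSpaces

variable {E : Type*} [NormedAddCommGroup E] [InnerProductSpace ℝ E] [FiniteDimensional ℝ E]
  [MeasurableSpace E] [BorelSpace E]

/-! ### Local Sobolev regularity of functions -/

/-- **`h ∈ H^s_loc`** for a function `h : E → ℂ` (Folland, *Introduction to PDE*, §6.A,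
Proposition (6.13): `f ∈ H_s^{loc}` iff `φf ∈ H_s` for all `φ ∈ C_c^∞`): for every smooth compactly
supported cut-off `χ : E → ℂ`, the distribution `T_{χh} = fnTD (χ·h)` lies in Mathlib's
Bessel-potential class `MemSobolev s 2`. (Meaningful for locally square-integrable `h`, e.g.
continuous `h`, for which `χh ∈ L²` and `fnTD` takes no junk value.)
[cite: Folland1995PDE, §6.A Proposition (6.13)] -/
def LocallyHs (s : ℝ) (h : E → ℂ) : Prop :=
  ∀ χ : E → ℂ, ContDiff ℝ ∞ χ → HasCompactSupport χ →
    MemSobolev s 2 (fnTD (fun x => χ x * h x))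

/-- `H^s_loc ⊆ H^{s'}_loc` for `s' ≤ s`. [folklore] -/
theorem LocallyHs.mono {s s' : ℝ} (hs : s' ≤ s) {h : E → ℂ} (hh : LocallyHs s h) :
    LocallyHs s' h :=
  fun χ hχ hχs => (hh χ hχ hχs).mono hs

/-- **`C^k ⊂ H^k_loc`** (`χh ∈ C^k_c ⊂ H^k`, `memSobolev_fnTD_of_contDiff`). [folklore] -/
theorem locallyHs_of_contDiff {k : ℕ} {h : E → ℂ} (hh : ContDiff ℝ k h) : LocallyHs k h :=
  fun χ hχ hχs => memSobolev_fnTD_of_contDiff ((hχ.of_le (by exact_mod_cast le_top)).mul hh)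
    hχs.mul_right

/-- Smooth functions are in every `H^s_loc`. [folklore] -/
theorem locallyHs_of_contDiff_infty {h : E → ℂ} (hh : ContDiff ℝ ∞ h) (s : ℝ) : LocallyHs s h :=
  (locallyHs_of_contDiff (k := ⌈s⌉₊) (hh.of_le (by exact_mod_cast le_top))).mono (Nat.le_ceil s)

/-- `H^s_loc` is closed under addition (of continuous functions). [folklore] -/
theorem LocallyHs.add {s : ℝ} {h₁ h₂ : E → ℂ} (hc₁ : Continuous h₁) (hc₂ : Continuous h₂)
    (hh₁ : LocallyHs s h₁) (hh₂ : LocallyHs s h₂) : LocallyHs s (fun x => h₁ x + h₂ x) := by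
  intro χ hχ hχs
  have e : (fun x => χ x * (h₁ x + h₂ x)) = fun x => χ x * h₁ x + χ x * h₂ x := by
    funext x; simp [mul_add]
  rw [e, fnTD_add (memLp_cutoff_mul hχ hχs hc₁) (memLp_cutoff_mul hχ hχs hc₂)]
  exact (hh₁ χ hχ hχs).add (hh₂ χ hχ hχs)

/-- `H^s_loc` is closed under multiplication by constants. [folklore] -/
theorem LocallyHs.const_mul {s : ℝ} {h : E → ℂ} (hc : Continuous h) (hh : LocallyHs s h) (c : ℂ) :
    LocallyHs s (fun x => c * h x) := by
  intro χ hχ hχs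
  have e : (fun x => χ x * (c * h x)) = fun x => c * (χ x * h x) := by
    funext x; ring
  rw [e, fnTD_const_mul (memLp_cutoff_mul hχ hχs hc)]
  exact (hh χ hχ hχs).smul c

/-- `H^s_loc` is closed under negation. [folklore] -/
theorem LocallyHs.neg {s : ℝ} {h : E → ℂ} (hc : Continuous h) (hh : LocallyHs s h) :
    LocallyHs s (fun x => -h x) := by
  have := hh.const_mul hc (-1)
  simpa using this

/-- `H^s_loc` is closed under subtraction. [folklore] -/
theorem LocallyHs.sub {s : ℝ} {h₁ h₂ : E → ℂ} (hc₁ : Continuous h₁) (hc₂ : Continuous h₂)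
    (hh₁ : LocallyHs s h₁) (hh₂ : LocallyHs s h₂) : LocallyHs s (fun x => h₁ x - h₂ x) := by
  simpa [sub_eq_add_neg] using hh₁.add hc₁ hc₂.neg (hh₂.neg hc₂)

/-- `H^s_loc` is closed under finite sums. [folklore] -/
theorem LocallyHs.finset_sum {ι : Type*} {s : ℝ} (S : Finset ι) {h : ι → E → ℂ}
    (hc : ∀ i, Continuous (h i)) (hh : ∀ i, LocallyHs s (h i)) :
    LocallyHs s (fun x => ∑ i ∈ S, h i x) := by
  classical
  induction S using Finset.induction_on with
  | empty =>
    simp only [Finset.sum_empty]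
    exact locallyHs_of_contDiff_infty contDiff_const s
  | insert a S ha ih =>
    simp only [Finset.sum_insert ha]
    exact (hh a).add (hc a) (continuous_finsetSum _ fun i _ => hc i) ih

/-- **Differentiation costs one local derivative**: `h ∈ C¹ ∩ H^s_loc ⇒ ∂ᵥh ∈ H^{s-1}_loc`
(`T_{χ ∂ᵥh} = ∂ᵥ T_{χh} - T_{(∂ᵥχ) h}` by `lineDerivOp_fnTD`, and `∂ᵥ : H^s → H^{s-1}`,
Mathlib's `MemSobolev.lineDerivOp`; Folland, Theorem (6.3)). [cite: Folland1995PDE, §6.A Theorem (6.3), p. 192] -/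
theorem LocallyHs.fderiv_apply {s : ℝ} {h : E → ℂ} (hc : ContDiff ℝ 1 h) (hh : LocallyHs s h)
    (v : E) : LocallyHs (s - 1) (fun x => fderiv ℝ h x v) := by
  intro χ hχ hχs
  have hχ1 : ContDiff ℝ 1 χ := hχ.of_le (by exact_mod_cast le_top)
  have hd : ∀ x, fderiv ℝ (fun y => χ y * h y) x v =
      fderiv ℝ χ x v * h x + χ x * fderiv ℝ h x v := fun x =>
    fderiv_mul_apply_comm ((hχ1.differentiable one_ne_zero) x) ((hc.differentiable one_ne_zero) x) v
  have hD := lineDerivOp_fnTD (hχ1.mul hc) (hχs.mul_right (f' := h)) v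
  simp_rw [hd] at hD
  have m1 : MemLp (fun x => fderiv ℝ χ x v * h x) 2 (volume : Measure E) :=
    (((hχ.continuous_fderiv (by simp)).clm_apply continuous_const).mul hc.continuous)
      |>.memLp_of_hasCompactSupport (hχs.fderiv_apply (𝕜 := ℝ) v).mul_right
  have m2 : MemLp (fun x => χ x * fderiv ℝ h x v) 2 (volume : Measure E) :=
    (hχ.continuous.mul ((hc.continuous_fderiv one_ne_zero).clm_apply continuous_const))
      |>.memLp_of_hasCompactSupport hχs.mul_right
  have e : fnTD (fun x => χ x * fderiv ℝ h x v) =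
      ∂_{v} (fnTD fun y => χ y * h y) - fnTD (fun x => fderiv ℝ χ x v * h x) := by
    rw [hD, fnTD_add m1 m2, add_sub_cancel_left]
  rw [e]
  refine ((hh χ hχ hχs).lineDerivOp (m := v)).sub ?_
  exact (hh _ ((hχ.fderiv_right (m := ∞) (by norm_cast)).clm_apply contDiff_const)
    (hχs.fderiv_apply (𝕜 := ℝ) v)).mono (by linarith)

/-- **Products in `H^s_loc` above the critical exponent**: for continuous `h₁, h₂ ∈ H^s_loc`
with `d < 2s`, `h₁h₂ ∈ H^s_loc` (insert a smooth bump `χ₁ ≡ 1` on `supp χ`, so that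
`χ h₁h₂ = (χ₁h₁)(χh₂)`, and apply the product law `memSobolev_fnTD_mul`; Folland, §6.A
Exercise 4). [cite: Folland1995PDE, §6.A Exercise 4] -/
theorem LocallyHs.mul {s : ℝ} (hsd : (Module.finrank ℝ E : ℝ) < 2 * s) {h₁ h₂ : E → ℂ}
    (hc₁ : Continuous h₁) (hc₂ : Continuous h₂) (hh₁ : LocallyHs s h₁) (hh₂ : LocallyHs s h₂) :
    LocallyHs s (fun x => h₁ x * h₂ x) := by
  intro χ hχ hχs
  obtain ⟨R, hR⟩ := (hχs.isBounded).subset_closedBall (0 : E)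
  let bump : ContDiffBump (0 : E) := ⟨max R 0 + 1, max R 0 + 2, by positivity, by linarith⟩
  set χ₁ : E → ℂ := fun x => (bump x : ℂ) with hχ₁def
  have hχ₁ : ContDiff ℝ ∞ χ₁ := Complex.ofRealCLM.contDiff.comp bump.contDiff
  have hχ₁s : HasCompactSupport χ₁ := bump.hasCompactSupport.comp_left Complex.ofReal_zero
  have hone : ∀ x ∈ tsupport χ, χ₁ x = 1 := fun x hx => by
    have hx' : x ∈ Metric.closedBall (0 : E) bump.rIn := by
      have := hR hx
      rw [Metric.mem_closedBall] at this ⊢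
      change dist x 0 ≤ max R 0 + 1
      linarith [le_max_left R 0]
    simp [hχ₁def, bump.one_of_mem_closedBall hx']
  have e : (fun x => χ x * (h₁ x * h₂ x)) = fun x => (χ₁ x * h₁ x) * (χ x * h₂ x) := by
    funext x
    by_cases hx : x ∈ tsupport χ
    · rw [hone x hx]; ring
    · rw [image_eq_zero_of_notMem_tsupport hx]; ring
  rw [e]
  exact memSobolev_fnTD_mul (hχ₁.continuous.mul hc₁) hχ₁s.mul_right (hχ.continuous.mul hc₂)
    hχs.mul_right hsd (hh₁ χ₁ hχ₁ hχ₁s) (hh₂ χ hχ hχs)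

/-- **Local elliptic regularity for `Δ`** (Folland, *Introduction to PDE*, Theorem (6.33) for
`L = Δ`, in the one-derivative-at-a-time form of its proof): if `P ∈ C¹` has the continuous
weak Laplacian `q` (`∫ P Σᵢ∂ᵢ∂ᵢψ = ∫ q ψ` for smooth compactly supported `ψ`, `(bᵢ)` an
orthonormal basis), `P ∈ H^{s-1}_loc` and `q ∈ H^{s-2}_loc`, then `P ∈ H^s_loc`. Proof:
`Δ T_{χP} = T_{χq + 2Σ∂ᵢχ∂ᵢP + (Δχ)P} ∈ H^{s-2}` (`laplacian_fnTD_mul_eq`, `fderiv_apply`) and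
`T_{χP} ∈ H^{s-2}`, so `T_{χP} ∈ H^s` (`MemSobolev.of_laplacian`).
[cite: Folland1995PDE, §6.C Theorem (6.33)] -/
theorem LocallyHs.of_weakLaplacian {ι : Type*} [Fintype ι] (b : OrthonormalBasis ι ℝ E)
    {s : ℝ} {P q : E → ℂ} (hP : ContDiff ℝ 1 P) (hq : Continuous q)
    (hPq : ∀ ψ : E → ℂ, ContDiff ℝ ∞ ψ → HasCompactSupport ψ →
      ∫ x, P x * ∑ i, fderiv ℝ (fun y => fderiv ℝ ψ y (b i)) x (b i) = ∫ x, q x * ψ x)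
    (h1 : LocallyHs (s - 1) P) (h2 : LocallyHs (s - 2) q) : LocallyHs s P := by
  intro χ hχ hχs
  refine MemSobolev.of_laplacian ((h1 χ hχ hχs).mono (by linarith)) ?_
  rw [laplacian_fnTD_mul_eq b hP hq hPq hχ hχs]
  have hdχ : ∀ i, ContDiff ℝ ∞ (fun x => fderiv ℝ χ x (b i)) := fun i =>
    (hχ.fderiv_right (m := ∞) (by norm_cast)).clm_apply contDiff_const
  have hdχs : ∀ i, HasCompactSupport (fun x => fderiv ℝ χ x (b i)) := fun i =>
    hχs.fderiv_apply (𝕜 := ℝ) (b i)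
  have hddχ : ∀ i, ContDiff ℝ ∞ (fun x => fderiv ℝ (fun y => fderiv ℝ χ y (b i)) x (b i)) :=
    fun i => ((hdχ i).fderiv_right (m := ∞) (by norm_cast)).clm_apply contDiff_const
  have hddχs : ∀ i, HasCompactSupport (fun x => fderiv ℝ (fun y => fderiv ℝ χ y (b i)) x (b i)) :=
    fun i => (hdχs i).fderiv_apply (𝕜 := ℝ) (b i)
  have hdPc : ∀ i, Continuous (fun x => fderiv ℝ P x (b i)) := fun i =>
    (hP.continuous_fderiv one_ne_zero).clm_apply continuous_const
  -- the three pieces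
  have hL : ContDiff ℝ ∞ (fun x => ∑ i, fderiv ℝ (fun y => fderiv ℝ χ y (b i)) x (b i)) :=
    ContDiff.sum fun i _ => hddχ i
  have hLs : HasCompactSupport (fun x => ∑ i, fderiv ℝ (fun y => fderiv ℝ χ y (b i)) x (b i)) := by
    refine HasCompactSupport.intro hχs fun x hx => Finset.sum_eq_zero fun i _ => ?_
    have hx' : x ∉ tsupport (fun y => fderiv ℝ χ y (b i)) := fun h =>
      hx (tsupport_fderiv_apply_subset ℝ (b i) h)
    rw [(notMem_tsupport_iff_eventuallyEq.mp hx').fderiv_eq]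
    simp
  have mA : MemLp (fun x => χ x * q x) 2 (volume : Measure E) := memLp_cutoff_mul hχ hχs hq
  have mB : ∀ i, MemLp (fun x => (2 * fderiv ℝ χ x (b i)) * fderiv ℝ P x (b i)) 2
      (volume : Measure E) := fun i =>
    memLp_cutoff_mul (contDiff_const.mul (hdχ i)) ((hdχs i).mul_left) (hdPc i)
  have mBs : MemLp (fun x => ∑ i, (2 * fderiv ℝ χ x (b i)) * fderiv ℝ P x (b i)) 2
      (volume : Measure E) := memLp_finsetSum _ fun i _ => mB i
  have mC : MemLp (fun x => (∑ i, fderiv ℝ (fun y => fderiv ℝ χ y (b i)) x (b i)) * P x) 2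
      (volume : Measure E) := memLp_cutoff_mul hL hLs hP.continuous
  have e : (fun x => χ x * q x + (2 * ∑ i, fderiv ℝ χ x (b i) * fderiv ℝ P x (b i) +
      (∑ i, fderiv ℝ (fun y => fderiv ℝ χ y (b i)) x (b i)) * P x)) =
      fun x => χ x * q x + ((∑ i, (2 * fderiv ℝ χ x (b i)) * fderiv ℝ P x (b i)) +
        (∑ i, fderiv ℝ (fun y => fderiv ℝ χ y (b i)) x (b i)) * P x) := by
    funext x
    simp only [Finset.mul_sum, mul_assoc]
  have mBC : MemLp (fun x => (∑ i, (2 * fderiv ℝ χ x (b i)) * fderiv ℝ P x (b i)) +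
      (∑ i, fderiv ℝ (fun y => fderiv ℝ χ y (b i)) x (b i)) * P x) 2 (volume : Measure E) :=
    mBs.add mC
  rw [e, fnTD_add mA mBC, fnTD_add mBs mC, fnTD_finset_sum _ fun i _ => mB i]
  refine (h2 χ hχ hχs).add (MemSobolev.add (memSobolev_finsetSum _ fun i _ => ?_) ?_)
  · have := (h1.fderiv_apply hP (b i)) (fun x => 2 * fderiv ℝ χ x (b i))
      (contDiff_const.mul (hdχ i)) ((hdχs i).mul_left)
    have es : s - 1 - 1 = s - 2 := by ring
    rw [es] at this
    exact this
  · exact (h1 _ hL hLs).mono (by linarith)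

/-- **The local Sobolev lemma**: a continuous `h ∈ H^s_loc` with `d < 2(s - k)` is `C^k`
(Folland, Theorem (6.5) with (6.45): smoothness is local, so test with a bump `χ ≡ 1` near each
point and apply `contDiff_of_memSobolev_fnTD` to `χh`). [cite: Folland1995PDE, §6.A Theorem (6.5)] -/
theorem LocallyHs.contDiff {s : ℝ} {k : ℕ} (hks : (Module.finrank ℝ E : ℝ) < 2 * (s - k))
    {h : E → ℂ} (hc : Continuous h) (hh : LocallyHs s h) : ContDiff ℝ k h := by
  refine contDiff_iff_contDiffAt.2 fun x => ?_
  let bump : ContDiffBump x := ⟨1, 2, one_pos, one_lt_two⟩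
  set χ : E → ℂ := fun y => (bump y : ℂ) with hχdef
  have hχ : ContDiff ℝ ∞ χ := Complex.ofRealCLM.contDiff.comp bump.contDiff
  have hχs : HasCompactSupport χ := bump.hasCompactSupport.comp_left Complex.ofReal_zero
  have hk : ContDiff ℝ k (fun y => χ y * h y) :=
    contDiff_of_memSobolev_fnTD (hχ.continuous.mul hc) hχs.mul_right hks (hh χ hχ hχs)
  have heq : h =ᶠ[nhds x] fun y => χ y * h y := by
    filter_upwards [bump.eventuallyEq_one] with y hy
    simp [hχdef, hy]
  exact hk.contDiffAt.congr_of_eventuallyEq heq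

end Literature.Analysis.FunctionSpaces
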